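import Mathlib.Analysis.SpecialFunctions.Pow.Real
import Mathlib.Analysis.Complex.Polynomial.Basic
import Mathlib.Analysis.SpecificLimits.Normed
import HarnessLib

/-!
# Quantitative deflation for a linear recurrence of ANY order: all characteristic roots in the disc `‖σ‖ ≤ R` ⇒ `‖w_n‖ ≤ C·(n+1)^d·Rⁿ`;
# a simple dominant root `1` ⇒ convergence with the same rate; and the elementary root-location certificate (module «LINEAR RECURRENCE DEFLATION — GENERAL ORDER»)

Topic `Literature/Analysis/Asymptotics` (continues a-p5's «LINEAR RECURRENCE DEFLATION» `LinearRecurrenceDeflation.lean` — `abs_le_of_rec_two` (order two) — and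
«DOMINANT ROOT» `LinearRecurrenceDominantRoot.lean` — `exists_tendsto_abs_sub_le_of_rec_three` (order three, dominant simple root); Mathlib's `LinearRecurrence`
(`Mathlib/Algebra/LinearRecurrence.lean`) is qualitative (solution space, `geom_sol_iff_root_charPoly`) and carries no bounds).  Lane «pcv-sawmu» (CriticalPhenomena
venture), a-p2 g28 — the model-free input of the width-three convergence car (`HOME/pub-sawmu-a-p2/g28/DESIGN-W3-CONVERGENCE.md` route (B)): the hat bridge sums of
`S₃` satisfy a scalar recurrence of order up to `24` whose characteristic roots other than `1` have modulus `≤ 0.4523` (kit j301570/j301983), so orders two and three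
no longer suffice.  Everything is elementary: recDeflate one root at a time (`(S − σ)` with `S` the shift), estimate the first-order inhomogeneous recurrence by the
discrete Duhamel formula, induct on the list of roots; over `ℂ` a monic polynomial is the product of `X − σ` over its roots (Mathlib: `IsAlgClosed`,
`prod_multiset_X_sub_C_of_monic_of_roots_card_eq`).  Source of the qualitative statement: R. P. Stanley, EC1 (2012) §4.1 Theorem 4.1.1 (iii) (a rational
generating function with poles of modulus `≥ 1/R` has coefficients `Σ P_i(n)γ_iⁿ`, `|γ_i| ≤ R`); the explicit constants and the certificate are lane arrangement.
Nothing below is quoted AS PRINTED.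

## What is proved (namespace `Literature.Analysis`; `S` = left shift on `ℕ → ℂ`)

* §1 `recDeflate rs w` (`= ∏_{σ∈rs}(S − σ) w`), `recDeflate_nil`, `recDeflate_cons`.
* §2 ★ `norm_le_of_shift_sub_mul` / `norm_le_of_shift_sub_mul'` — ONE STEP: `‖σ‖ ≤ R`, `0 < R`, `‖h_{n+1} − σh_n‖ ≤ C(n+1)^kRⁿ` ⇒
  `‖h_n‖ ≤ (‖h₀‖ + (C/R)·n·(n+1)^k)Rⁿ ≤ (‖h₀‖ + C/R)(n+1)^{k+1}Rⁿ`.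
* §3 ★★★ **`exists_norm_le_of_recDeflate`** (inhomogeneous, any order: `‖recDeflate rs w_n‖ ≤ C(n+1)^kRⁿ ⇒ ‖w_n‖ ≤ C'(n+1)^{k+|rs|}Rⁿ`),
  ★★★ **`exists_norm_le_of_recDeflate_eq_zero`** (homogeneous: `recDeflate rs w = 0 ⇒ ‖w_n‖ ≤ C'(n+1)^{|rs|}Rⁿ`), ★★ `tendsto_zero_of_recDeflate_eq_zero` (`R < 1 ⇒ w_n → 0`).
* §4 `natDegree_list_prod_X_sub_C_le`, ★★ **`recDeflate_eq_sum_coeff`**: `recDeflate rs w n = Σ_{j ≤ |rs|} c_j w_{n+j}` with `Σ c_jX^j = ∏_{σ∈rs}(X − σ)` — the deflated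
  sequence IS the recurrence expression.
* §5 ★★★ **`exists_norm_le_of_linearRecurrence`**: `p ∈ ℂ[X]` MONIC, every root in `‖z‖ ≤ R` (`0 < R`), `Σ_{j≤deg p} p_j w_{n+j} = 0 ∀ n` ⇒
  `‖w_n‖ ≤ C'(n+1)^{deg p}Rⁿ`; ★★ `tendsto_zero_of_linearRecurrence` (`R < 1`); ★★ **`norm_lt_of_isRoot_of_dominant`** — the CERTIFICATE: if
  `Σ_{j<d}‖a_j‖ρ^j < ‖a_d‖ρ^d` (`d = deg p`, `ρ > 0`) then every root of `p` has `‖z‖ < ρ` (triangle inequality only).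
* §6 `recDeflate_sub`, `recDeflate_const`, `list_prod_one_sub_ne_zero_of_norm_lt_one`; ★★★ **`exists_norm_sub_le_of_recDeflate_const`** — simple dominant root `1`: if `recDeflate rs d` is constant
  (`d` solves the recurrence with characteristic polynomial `(X − 1)∏(X − σ)`, all `‖σ‖ ≤ R < 1`) then `‖d_n − L‖ ≤ C'(n+1)^{|rs|}Rⁿ` with the EXPLICIT limit
  `L = recDeflate rs d 0/∏(1 − σ)`; ★★ `exists_norm_sub_le_of_linearRecurrence_one` (the same from a monic `q` and `Σ_j q_j(d_{n+1+j} − d_{n+j}) = 0`).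

Label: LANE THEOREM (own arrangement of lane «pcv-sawmu», a-p2 g28, 2026-08-28; the qualitative content is Stanley EC1 Thm 4.1.1 (iii)).  NOT claimed: the sharp
polynomial degree `(multiplicity − 1)` (we allow `(n+1)^{|rs|}`), explicit optimal `C'`, real-sequence repackagings (apply with `w n := (v n : ℂ)`).
-/

noncomputable section

open Finset Filter Topology Polynomial

namespace Literature.Analysis

/-! ## §1 Deflation by a list of roots -/

/-- Deflation of a complex sequence by a list of roots: `recDeflate [] w = w`, `recDeflate (σ :: rs) w = (S − σ)(recDeflate rs w)` with `S` the left shift,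
i.e. `recDeflate [σ₁,…,σ_d] w = ∏_i (S − σ_i) w` — the sequence `n ↦ Σ_j c_j w_{n+j}` where `Σ_j c_j X^j = ∏_i (X − σ_i)` (see `recDeflate_eq_sum_coeff`).
[cite: Stanley2012EC1, §4.1 Theorem 4.1.1 (iii) (linear recurrences with constant coefficients); lane arrangement] -/
def recDeflate : List ℂ → (ℕ → ℂ) → ℕ → ℂ
  | [], w => w
  | σ :: rs, w => fun n => recDeflate rs w (n + 1) - σ * recDeflate rs w n

/-- `recDeflate [] w = w` (plumbing). [cite: Stanley2012EC1, §4.1; lane plumbing] -/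
@[simp] theorem recDeflate_nil (w : ℕ → ℂ) : recDeflate [] w = w := rfl

/-- `recDeflate (σ :: rs) w n = recDeflate rs w (n+1) − σ · recDeflate rs w n` (plumbing). [cite: Stanley2012EC1, §4.1; lane plumbing] -/
@[simp] theorem recDeflate_cons (σ : ℂ) (rs : List ℂ) (w : ℕ → ℂ) (n : ℕ) :
    recDeflate (σ :: rs) w n = recDeflate rs w (n + 1) - σ * recDeflate rs w n := rfl

/-! ## §2 One deflation step: a first-order inhomogeneous recurrence with a polynomially-geometric source -/

/-- ★ **One step.**  If `‖σ‖ ≤ R`, `0 < R`, and `‖h_{n+1} − σ h_n‖ ≤ C·(n+1)^k·Rⁿ` for all `n` (`C ≥ 0`), then for every `n`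
`‖h_n‖ ≤ (‖h₀‖ + (C/R)·n·(n+1)^k)·Rⁿ` — the discrete Duhamel formula `h_n = σⁿh₀ + Σ_{i<n} σ^{n−1−i} g_i` estimated term by term.
[cite: Stanley2012EC1, §4.1 Theorem 4.1.1 (iii); lane statement with explicit constants] -/
theorem norm_le_of_shift_sub_mul {σ : ℂ} {R C : ℝ} {k : ℕ} (hR : 0 < R) (hσ : ‖σ‖ ≤ R) (hC : 0 ≤ C) {h : ℕ → ℂ}
    (hg : ∀ n : ℕ, ‖h (n + 1) - σ * h n‖ ≤ C * ((n : ℝ) + 1) ^ k * R ^ n) (n : ℕ) :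
    ‖h n‖ ≤ (‖h 0‖ + C / R * n * ((n : ℝ) + 1) ^ k) * R ^ n := by
  induction n with
  | zero => simp
  | succ n ih =>
    have hstep : ‖h (n + 1)‖ ≤ R * ‖h n‖ + C * ((n : ℝ) + 1) ^ k * R ^ n := by
      have e : h (n + 1) = σ * h n + (h (n + 1) - σ * h n) := by ring
      calc ‖h (n + 1)‖ = ‖σ * h n + (h (n + 1) - σ * h n)‖ := by rw [← e]
        _ ≤ ‖σ * h n‖ + ‖h (n + 1) - σ * h n‖ := norm_add_le _ _
        _ ≤ R * ‖h n‖ + C * ((n : ℝ) + 1) ^ k * R ^ n := by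
            rw [norm_mul]
            exact add_le_add (mul_le_mul_of_nonneg_right hσ (norm_nonneg _)) (hg n)
    have hpow : ((n : ℝ) + 1) ^ k ≤ ((n : ℝ) + 1 + 1) ^ k := pow_le_pow_left₀ (by positivity) (by linarith) k
    have hCR : 0 ≤ C / R := div_nonneg hC hR.le
    calc ‖h (n + 1)‖ ≤ R * ‖h n‖ + C * ((n : ℝ) + 1) ^ k * R ^ n := hstep
      _ ≤ R * ((‖h 0‖ + C / R * n * ((n : ℝ) + 1) ^ k) * R ^ n) + C * ((n : ℝ) + 1) ^ k * R ^ n := by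
          have := mul_le_mul_of_nonneg_left ih hR.le; linarith
      _ = (‖h 0‖ + C / R * ((n : ℝ) + 1) * ((n : ℝ) + 1) ^ k) * R ^ (n + 1) := by
          field_simp
          ring
      _ ≤ (‖h 0‖ + C / R * ((n + 1 : ℕ) : ℝ) * (((n + 1 : ℕ) : ℝ) + 1) ^ k) * R ^ (n + 1) := by
          push_cast
          have h1 : C / R * ((n : ℝ) + 1) * ((n : ℝ) + 1) ^ k ≤ C / R * ((n : ℝ) + 1) * ((n : ℝ) + 1 + 1) ^ k :=
            mul_le_mul_of_nonneg_left hpow (by positivity)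
          have h2 : 0 ≤ R ^ (n + 1) := by positivity
          nlinarith

/-- The same with the simpler polynomial weight `(n+1)^{k+1}`: `‖h_n‖ ≤ (‖h₀‖ + C/R)·(n+1)^{k+1}·Rⁿ`. [cite: Stanley2012EC1, §4.1 Theorem 4.1.1 (iii); lane statement] -/
theorem norm_le_of_shift_sub_mul' {σ : ℂ} {R C : ℝ} {k : ℕ} (hR : 0 < R) (hσ : ‖σ‖ ≤ R) (hC : 0 ≤ C) {h : ℕ → ℂ}
    (hg : ∀ n : ℕ, ‖h (n + 1) - σ * h n‖ ≤ C * ((n : ℝ) + 1) ^ k * R ^ n) (n : ℕ) :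
    ‖h n‖ ≤ (‖h 0‖ + C / R) * ((n : ℝ) + 1) ^ (k + 1) * R ^ n := by
  have h1 := norm_le_of_shift_sub_mul hR hσ hC hg n
  have hCR : 0 ≤ C / R := div_nonneg hC hR.le
  have hn1 : (1 : ℝ) ≤ ((n : ℝ) + 1) ^ (k + 1) := one_le_pow₀ (by linarith [(Nat.cast_nonneg n : (0 : ℝ) ≤ n)])
  have hnk : (n : ℝ) * ((n : ℝ) + 1) ^ k ≤ ((n : ℝ) + 1) ^ (k + 1) := by
    rw [pow_succ']
    exact mul_le_mul_of_nonneg_right (by linarith) (by positivity)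
  have hRn : 0 ≤ R ^ n := by positivity
  calc ‖h n‖ ≤ (‖h 0‖ + C / R * n * ((n : ℝ) + 1) ^ k) * R ^ n := h1
    _ ≤ ((‖h 0‖ + C / R) * ((n : ℝ) + 1) ^ (k + 1)) * R ^ n := by
        apply mul_le_mul_of_nonneg_right _ hRn
        have e1 : ‖h 0‖ ≤ ‖h 0‖ * ((n : ℝ) + 1) ^ (k + 1) := le_mul_of_one_le_right (norm_nonneg _) hn1
        have e2 : C / R * n * ((n : ℝ) + 1) ^ k ≤ C / R * ((n : ℝ) + 1) ^ (k + 1) := by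
          rw [mul_assoc]; exact mul_le_mul_of_nonneg_left hnk hCR
        nlinarith
    _ = (‖h 0‖ + C / R) * ((n : ℝ) + 1) ^ (k + 1) * R ^ n := by ring

/-! ## §3 The general-order deflation bound -/

/-- ★★★ **Quantitative deflation, any order (inhomogeneous form).**  If every `σ ∈ rs` has `‖σ‖ ≤ R` (`0 < R`) and the fully deflated sequence is
polynomially-geometrically small, `‖(∏_{σ∈rs}(S − σ)) w_n‖ ≤ C·(n+1)^k·Rⁿ`, then `‖w_n‖ ≤ C'·(n+1)^{k + |rs|}·Rⁿ` for an explicit `C' ≥ 0` (induction on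
the list: one step of §2 per root).  [cite: Stanley2012EC1, §4.1 Theorem 4.1.1 (iii) (coefficient asymptotics of rational functions: poles of modulus `≤ R`
give `O(n^{m−1}Rⁿ)`); lane statement with constants, generalising the tree's orders two and three] -/
theorem exists_norm_le_of_recDeflate {R : ℝ} (hR : 0 < R) :
    ∀ (rs : List ℂ) (_hrs : ∀ σ ∈ rs, ‖σ‖ ≤ R) (k : ℕ) (C : ℝ) (_hC : 0 ≤ C) (w : ℕ → ℂ)
      (_hw : ∀ n : ℕ, ‖recDeflate rs w n‖ ≤ C * ((n : ℝ) + 1) ^ k * R ^ n),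
      ∃ C' : ℝ, 0 ≤ C' ∧ ∀ n : ℕ, ‖w n‖ ≤ C' * ((n : ℝ) + 1) ^ (k + rs.length) * R ^ n := by
  intro rs
  induction rs with
  | nil =>
    intro _ k C hC w hw
    exact ⟨C, hC, fun n => by simpa using hw n⟩
  | cons σ rs ih =>
    intro hrs k C hC w hw
    have hσ : ‖σ‖ ≤ R := hrs σ (by simp)
    have hrs' : ∀ τ ∈ rs, ‖τ‖ ≤ R := fun τ hτ => hrs τ (by simp [hτ])
    -- the partially deflated sequence `h = recDeflate rs w` satisfies the one-step hypothesis
    have hstep : ∀ n : ℕ, ‖recDeflate rs w (n + 1) - σ * recDeflate rs w n‖ ≤ C * ((n : ℝ) + 1) ^ k * R ^ n := fun n => by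
      simpa using hw n
    have hh : ∀ n : ℕ, ‖recDeflate rs w n‖ ≤ (‖recDeflate rs w 0‖ + C / R) * ((n : ℝ) + 1) ^ (k + 1) * R ^ n :=
      norm_le_of_shift_sub_mul' hR hσ hC hstep
    obtain ⟨C', hC', hb⟩ := ih hrs' (k + 1) (‖recDeflate rs w 0‖ + C / R) (by positivity) w hh
    refine ⟨C', hC', fun n => ?_⟩
    have e : k + (σ :: rs).length = k + 1 + rs.length := by simp; ring
    rw [e]
    exact hb n

/-- ★★★ **Homogeneous form.**  If `‖σ‖ ≤ R` for every `σ ∈ rs` (`0 < R`) and `(∏_{σ∈rs}(S − σ)) w = 0`, then `‖w_n‖ ≤ C'·(n+1)^{|rs|}·Rⁿ` for all `n`.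
[cite: Stanley2012EC1, §4.1 Theorem 4.1.1 (iii); lane statement] -/
theorem exists_norm_le_of_recDeflate_eq_zero {R : ℝ} (hR : 0 < R) {rs : List ℂ} (hrs : ∀ σ ∈ rs, ‖σ‖ ≤ R) {w : ℕ → ℂ}
    (hw : ∀ n : ℕ, recDeflate rs w n = 0) : ∃ C' : ℝ, 0 ≤ C' ∧ ∀ n : ℕ, ‖w n‖ ≤ C' * ((n : ℝ) + 1) ^ rs.length * R ^ n := by
  obtain ⟨C', hC', hb⟩ := exists_norm_le_of_recDeflate hR rs hrs 0 0 le_rfl w (fun n => by rw [hw n, norm_zero]; positivity)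
  exact ⟨C', hC', fun n => by simpa using hb n⟩

/-- ★★ **Geometric decay.**  Under the hypotheses of the homogeneous form with `R < 1`: `w_n → 0`; more precisely `w_n = O((n+1)^{|rs|} Rⁿ)`.
[cite: Stanley2012EC1, §4.1 Theorem 4.1.1 (iii); lane statement] -/
theorem tendsto_zero_of_recDeflate_eq_zero {R : ℝ} (hR : 0 < R) (hR1 : R < 1) {rs : List ℂ} (hrs : ∀ σ ∈ rs, ‖σ‖ ≤ R) {w : ℕ → ℂ}
    (hw : ∀ n : ℕ, recDeflate rs w n = 0) : Tendsto w atTop (𝓝 0) := by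
  obtain ⟨C', hC', hb⟩ := exists_norm_le_of_recDeflate_eq_zero hR hrs hw
  -- `(n+1)^d R^n = R⁻¹ · (n+1)^d R^(n+1) → 0`
  have h0 : Tendsto (fun n : ℕ => ((n : ℝ)) ^ rs.length * R ^ n) atTop (𝓝 0) :=
    tendsto_pow_const_mul_const_pow_of_lt_one rs.length hR.le hR1
  have h1 : Tendsto (fun n : ℕ => (((n + 1 : ℕ) : ℝ)) ^ rs.length * R ^ (n + 1)) atTop (𝓝 0) := h0.comp (tendsto_add_atTop_nat 1)
  have h2 : Tendsto (fun n : ℕ => C' * ((n : ℝ) + 1) ^ rs.length * R ^ n) atTop (𝓝 0) := by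
    have h3 := (h1.const_mul (C' * R⁻¹))
    rw [mul_zero] at h3
    refine h3.congr fun n => ?_
    push_cast
    field_simp
    ring
  refine squeeze_zero_norm (fun n => hb n) h2

/-! ## §4 The deflation operator in coefficient form -/

/-- The product `∏_{σ∈rs}(X − σ)` has degree at most `|rs|` (plumbing; equality holds, only `≤` is used). [cite: Stanley2012EC1, §4.1; lane plumbing] -/
theorem natDegree_list_prod_X_sub_C_le (rs : List ℂ) : ((rs.map fun σ => X - C σ).prod).natDegree ≤ rs.length := by
  induction rs with
  | nil => simp
  | cons σ rs ih =>
    simp only [List.map_cons, List.prod_cons, List.length_cons]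
    calc ((X - C σ) * (rs.map fun σ => X - C σ).prod).natDegree ≤ (X - C σ).natDegree + ((rs.map fun σ => X - C σ).prod).natDegree :=
          natDegree_mul_le
      _ ≤ 1 + rs.length := by rw [natDegree_X_sub_C]; omega
      _ = rs.length + 1 := by ring

/-- ★★ **Coefficient form of the deflation**: `(∏_{σ∈rs}(S − σ)) w_n = Σ_{j ≤ |rs|} c_j · w_{n+j}` where `Σ_j c_j X^j = ∏_{σ∈rs}(X − σ)` — the deflated sequence
IS the linear-recurrence expression with the characteristic polynomial's coefficients. [cite: Stanley2012EC1, §4.1 Theorem 4.1.1; lane statement] -/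
theorem recDeflate_eq_sum_coeff (rs : List ℂ) (w : ℕ → ℂ) (n : ℕ) :
    recDeflate rs w n = ∑ j ∈ range (rs.length + 1), ((rs.map fun σ => X - C σ).prod).coeff j * w (n + j) := by
  induction rs generalizing n with
  | nil => simp
  | cons σ rs ih =>
    set P : ℂ[X] := (rs.map fun σ => X - C σ).prod with hP
    have hdeg : P.coeff (rs.length + 1) = 0 := coeff_eq_zero_of_natDegree_lt (by have := natDegree_list_prod_X_sub_C_le rs; rw [← hP] at this; omega)
    have hc0 : ((X - C σ) * P).coeff 0 = -(σ * P.coeff 0) := by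
      rw [sub_mul, coeff_sub, coeff_X_mul_zero, coeff_C_mul]; ring
    have hcs : ∀ j, ((X - C σ) * P).coeff (j + 1) = P.coeff j - σ * P.coeff (j + 1) := fun j => by
      rw [sub_mul, coeff_sub, coeff_X_mul, coeff_C_mul]
    simp only [recDeflate_cons, List.map_cons, List.prod_cons, List.length_cons, ih]
    rw [← hP]
    conv_rhs => rw [Finset.sum_range_succ', hc0]
    simp only [hcs]
    simp only [sub_mul, Finset.sum_sub_distrib]
    -- the `σ`-part: `Σ_{j<L+1} σ P_{j+1} w_{n+j+1} + σ P_0 w_n = σ Σ_{j<L+1} P_j w_{n+j}` (top coefficient vanishes)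
    have hshift : ∑ j ∈ range (rs.length + 1), σ * P.coeff (j + 1) * w (n + (j + 1)) + σ * P.coeff 0 * w (n + 0)
        = σ * ∑ j ∈ range (rs.length + 1), P.coeff j * w (n + j) := by
      have e : ∑ j ∈ range (rs.length + 1 + 1), σ * P.coeff j * w (n + j) = σ * ∑ j ∈ range (rs.length + 1), P.coeff j * w (n + j) := by
        rw [Finset.sum_range_succ, hdeg, Finset.mul_sum]
        simp only [mul_zero, zero_mul, add_zero]
        exact Finset.sum_congr rfl fun j _ => by ring
      rw [← e, Finset.sum_range_succ' (fun j => σ * P.coeff j * w (n + j))]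
    have hmain : ∑ j ∈ range (rs.length + 1), P.coeff j * w (n + (j + 1)) = ∑ j ∈ range (rs.length + 1), P.coeff j * w (n + 1 + j) :=
      Finset.sum_congr rfl fun j _ => by rw [show n + (j + 1) = n + 1 + j by ring]
    rw [hmain]
    linear_combination hshift

/-! ## §5 The user-facing form: a monic characteristic polynomial with all roots in the disc `‖z‖ ≤ R` -/

/-- ★★★ **Linear recurrences of any order: root bound ⇒ geometric bound with explicit polynomial factor.**  Let `p ∈ ℂ[X]` be MONIC with all roots in
`‖z‖ ≤ R` (`0 < R`), and let `w : ℕ → ℂ` satisfy the recurrence `Σ_{j ≤ deg p} p_j · w_{n+j} = 0` for every `n`.  Then `‖w_n‖ ≤ C'·(n+1)^{deg p}·Rⁿ` for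
all `n`, for some `C' ≥ 0`.  (Over `ℂ` the monic `p` is the product of `X − σ` over its roots; recDeflate root by root.)  The tree's `abs_le_of_rec_two` /
`exists_tendsto_abs_sub_le_of_rec_three` are the orders `2`, `3` with sharper constants. [cite: Stanley2012EC1, §4.1 Theorem 4.1.1 (iii) (rational generating
functions ⇔ exponential polynomials; poles of modulus `≥ 1/R` ⇔ growth `O(n^{m−1}Rⁿ)`); lane statement] -/
theorem exists_norm_le_of_linearRecurrence {p : ℂ[X]} (hp : p.Monic) {R : ℝ} (hR : 0 < R) (hroot : ∀ z : ℂ, p.IsRoot z → ‖z‖ ≤ R) {w : ℕ → ℂ}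
    (hw : ∀ n : ℕ, ∑ j ∈ range (p.natDegree + 1), p.coeff j * w (n + j) = 0) :
    ∃ C' : ℝ, 0 ≤ C' ∧ ∀ n : ℕ, ‖w n‖ ≤ C' * ((n : ℝ) + 1) ^ p.natDegree * R ^ n := by
  set rs : List ℂ := p.roots.toList with hrs
  have hcard : Multiset.card p.roots = p.natDegree := IsAlgClosed.card_roots_eq_natDegree
  have hprod : (rs.map fun σ => X - C σ).prod = p := by
    have h := prod_multiset_X_sub_C_of_monic_of_roots_card_eq hp hcard
    rw [hrs, ← Multiset.prod_coe, ← Multiset.map_coe, Multiset.coe_toList]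
    exact h
  have hlen : rs.length = p.natDegree := by rw [hrs, Multiset.length_toList, hcard]
  have hmem : ∀ σ ∈ rs, ‖σ‖ ≤ R := fun σ hσ => by
    rw [hrs, Multiset.mem_toList, mem_roots hp.ne_zero] at hσ
    exact hroot σ hσ
  have hdefl : ∀ n, recDeflate rs w n = 0 := fun n => by
    rw [recDeflate_eq_sum_coeff, hprod, hlen]; exact hw n
  obtain ⟨C', hC', hb⟩ := exists_norm_le_of_recDeflate_eq_zero hR hmem hdefl
  exact ⟨C', hC', fun n => by rw [← hlen]; exact hb n⟩

/-- ★★ **Geometric convergence to zero** under the same hypotheses with `R < 1`. [cite: Stanley2012EC1, §4.1 Theorem 4.1.1 (iii); lane statement] -/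
theorem tendsto_zero_of_linearRecurrence {p : ℂ[X]} (hp : p.Monic) {R : ℝ} (hR : 0 < R) (hR1 : R < 1) (hroot : ∀ z : ℂ, p.IsRoot z → ‖z‖ ≤ R)
    {w : ℕ → ℂ} (hw : ∀ n : ℕ, ∑ j ∈ range (p.natDegree + 1), p.coeff j * w (n + j) = 0) : Tendsto w atTop (𝓝 0) := by
  set rs : List ℂ := p.roots.toList with hrs
  have hcard : Multiset.card p.roots = p.natDegree := IsAlgClosed.card_roots_eq_natDegree
  have hprod : (rs.map fun σ => X - C σ).prod = p := by
    have h := prod_multiset_X_sub_C_of_monic_of_roots_card_eq hp hcard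
    rw [hrs, ← Multiset.prod_coe, ← Multiset.map_coe, Multiset.coe_toList]
    exact h
  have hlen : rs.length = p.natDegree := by rw [hrs, Multiset.length_toList, hcard]
  have hmem : ∀ σ ∈ rs, ‖σ‖ ≤ R := fun σ hσ => by
    rw [hrs, Multiset.mem_toList, mem_roots hp.ne_zero] at hσ
    exact hroot σ hσ
  have hdefl : ∀ n, recDeflate rs w n = 0 := fun n => by
    rw [recDeflate_eq_sum_coeff, hprod, hlen]; exact hw n
  exact tendsto_zero_of_recDeflate_eq_zero hR hR1 hmem hdefl

/-- ★★ **The elementary root-location certificate** used with the above: if `p = Σ_{j≤d} a_j X^j` has `Σ_{j<d} ‖a_j‖ ρ^j < ‖a_d‖ ρ^d` for some `ρ > 0`, then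
every root `z` of `p` has `‖z‖ < ρ` (for `‖z‖ ≥ ρ`: `‖p(z)‖ ≥ ‖a_d‖‖z‖^d − Σ_{j<d}‖a_j‖‖z‖^j ≥ ‖z‖^d·(‖a_d‖ − Σ_{j<d}‖a_j‖ρ^{j−d}) > 0`).  No Rouché, no
argument principle. [cite: Stanley2012EC1, §4.1 (root moduli govern the growth); lane statement — a Cauchy-type bound] -/
theorem norm_lt_of_isRoot_of_dominant {p : ℂ[X]} {d : ℕ} (hd : p.natDegree = d) {ρ : ℝ} (hρ : 0 < ρ)
    (hdom : ∑ j ∈ range d, ‖p.coeff j‖ * ρ ^ j < ‖p.coeff d‖ * ρ ^ d) {z : ℂ} (hz : p.IsRoot z) : ‖z‖ < ρ := by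
  by_contra hge
  push Not at hge
  have hz0 : 0 < ‖z‖ := lt_of_lt_of_le hρ hge
  -- `p(z) = a_d z^d + Σ_{j<d} a_j z^j`
  have heval : p.eval z = ∑ j ∈ range (d + 1), p.coeff j * z ^ j := by
    rw [eval_eq_sum_range, hd]
  rw [IsRoot.def, heval, Finset.sum_range_succ] at hz
  -- so `‖a_d‖ ‖z‖^d ≤ Σ_{j<d} ‖a_j‖ ‖z‖^j`
  have hle : ‖p.coeff d‖ * ‖z‖ ^ d ≤ ∑ j ∈ range d, ‖p.coeff j‖ * ‖z‖ ^ j := by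
    have e : p.coeff d * z ^ d = -∑ j ∈ range d, p.coeff j * z ^ j := by linear_combination hz
    calc ‖p.coeff d‖ * ‖z‖ ^ d = ‖p.coeff d * z ^ d‖ := by rw [norm_mul, norm_pow]
      _ = ‖∑ j ∈ range d, p.coeff j * z ^ j‖ := by rw [e, norm_neg]
      _ ≤ ∑ j ∈ range d, ‖p.coeff j * z ^ j‖ := norm_sum_le _ _
      _ = ∑ j ∈ range d, ‖p.coeff j‖ * ‖z‖ ^ j := Finset.sum_congr rfl fun j _ => by rw [norm_mul, norm_pow]
  -- compare with the same sums at radius ρ ≤ ‖z‖: divide by ‖z‖^d and use monotonicity of ρ^{j-d} (j < d)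
  have hcmp : ∑ j ∈ range d, ‖p.coeff j‖ * ‖z‖ ^ j ≤ (∑ j ∈ range d, ‖p.coeff j‖ * ρ ^ j) * (‖z‖ / ρ) ^ d := by
    rw [Finset.sum_mul]
    refine Finset.sum_le_sum fun j hj => ?_
    rw [Finset.mem_range] at hj
    -- ‖a_j‖ ‖z‖^j ≤ ‖a_j‖ ρ^j (‖z‖/ρ)^d  since (‖z‖/ρ)^j ≤ (‖z‖/ρ)^d
    have hq : 1 ≤ ‖z‖ / ρ := by rw [le_div_iff₀ hρ]; linarith
    have hpow : (‖z‖ / ρ) ^ j ≤ (‖z‖ / ρ) ^ d := pow_le_pow_right₀ hq hj.le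
    have e : ‖z‖ ^ j = ρ ^ j * (‖z‖ / ρ) ^ j := by rw [← mul_pow]; congr 1; field_simp
    rw [e, ← mul_assoc]
    exact mul_le_mul_of_nonneg_left hpow (by positivity)
  have hzd : ‖z‖ ^ d = ρ ^ d * (‖z‖ / ρ) ^ d := by rw [← mul_pow]; congr 1; field_simp
  have hpos : 0 < (‖z‖ / ρ) ^ d := by positivity
  have h1 : ‖p.coeff d‖ * ρ ^ d * (‖z‖ / ρ) ^ d ≤ (∑ j ∈ range d, ‖p.coeff j‖ * ρ ^ j) * (‖z‖ / ρ) ^ d := by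
    calc ‖p.coeff d‖ * ρ ^ d * (‖z‖ / ρ) ^ d = ‖p.coeff d‖ * ‖z‖ ^ d := by rw [hzd]; ring
      _ ≤ _ := hle.trans hcmp
  have h2 := lt_of_le_of_lt (le_of_mul_le_mul_right h1 hpos) hdom
  exact lt_irrefl _ h2

/-! ## §6 A simple dominant root `1`: convergence with the same geometric rate -/

/-- Deflation is linear: `recDeflate rs (u − v) = recDeflate rs u − recDeflate rs v` (plumbing). [cite: Stanley2012EC1, §4.1; lane plumbing] -/
theorem recDeflate_sub (rs : List ℂ) (u v : ℕ → ℂ) (n : ℕ) : recDeflate rs (fun m => u m - v m) n = recDeflate rs u n - recDeflate rs v n := by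
  induction rs generalizing n with
  | nil => simp
  | cons σ rs ih => simp only [recDeflate_cons, ih]; ring

/-- Deflation of a constant: `recDeflate rs (fun _ => c) n = c · ∏_{σ∈rs} (1 − σ)` (plumbing). [cite: Stanley2012EC1, §4.1; lane plumbing] -/
theorem recDeflate_const (rs : List ℂ) (c : ℂ) (n : ℕ) : recDeflate rs (fun _ => c) n = c * (rs.map fun σ => 1 - σ).prod := by
  induction rs generalizing n with
  | nil => simp
  | cons σ rs ih => simp only [recDeflate_cons, ih, List.map_cons, List.prod_cons]; ring

/-- `∏_{σ∈rs}(1 − σ) ≠ 0` when every `‖σ‖ < 1` (plumbing). [cite: Stanley2012EC1, §4.1; lane plumbing] -/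
theorem list_prod_one_sub_ne_zero_of_norm_lt_one {rs : List ℂ} (hrs : ∀ σ ∈ rs, ‖σ‖ < 1) : (rs.map fun σ => 1 - σ).prod ≠ 0 := by
  induction rs with
  | nil => simp
  | cons σ rs ih =>
    rw [List.map_cons, List.prod_cons]
    refine mul_ne_zero ?_ (ih fun τ hτ => hrs τ (by simp [hτ]))
    intro h
    have h1 : σ = 1 := by linear_combination -h
    have := hrs σ (by simp)
    rw [h1, norm_one] at this
    exact lt_irrefl _ this

/-- ★★★ **Simple dominant root `1`: convergence with geometric rate.**  If `‖σ‖ ≤ R < 1` for every `σ ∈ rs` and the sequence `d` satisfies the recurrence with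
characteristic polynomial `(X − 1)·∏_{σ∈rs}(X − σ)` — i.e. `recDeflate rs d` is CONSTANT — then with `L := (recDeflate rs d 0)/∏_{σ∈rs}(1 − σ)` one has
`‖d_n − L‖ ≤ C'·(n+1)^{|rs|}·Rⁿ` for all `n` (so `d_n → L` geometrically).  This is the shape in which a renewal / transfer-matrix sequence converges to its
limit: the generalisation to any order of the tree's `abs_sub_le_of_rec_two_shift` and `exists_tendsto_abs_sub_le_of_rec_three`.
[cite: Stanley2012EC1, §4.1 Theorem 4.1.1 (iii); lane statement] -/
theorem exists_norm_sub_le_of_recDeflate_const {R : ℝ} (hR : 0 < R) (hR1 : R < 1) {rs : List ℂ} (hrs : ∀ σ ∈ rs, ‖σ‖ ≤ R) {d : ℕ → ℂ}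
    (hd : ∀ n : ℕ, recDeflate rs d (n + 1) = recDeflate rs d n) :
    ∃ C' : ℝ, 0 ≤ C' ∧ ∀ n : ℕ, ‖d n - recDeflate rs d 0 / (rs.map fun σ => 1 - σ).prod‖ ≤ C' * ((n : ℝ) + 1) ^ rs.length * R ^ n := by
  set Q1 : ℂ := (rs.map fun σ => 1 - σ).prod with hQ1
  have hQ1ne : Q1 ≠ 0 := list_prod_one_sub_ne_zero_of_norm_lt_one fun σ hσ => lt_of_le_of_lt (hrs σ hσ) hR1
  set L : ℂ := recDeflate rs d 0 / Q1 with hL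
  have hconst : ∀ n, recDeflate rs d n = recDeflate rs d 0 := fun n => by
    induction n with
    | zero => rfl
    | succ n ih => rw [hd n, ih]
  have hzero : ∀ n, recDeflate rs (fun m => d m - L) n = 0 := fun n => by
    rw [recDeflate_sub, recDeflate_const, hconst n, ← hQ1, hL, div_mul_cancel₀ _ hQ1ne, sub_self]
  obtain ⟨C', hC', hb⟩ := exists_norm_le_of_recDeflate_eq_zero hR hrs hzero
  exact ⟨C', hC', hb⟩

/-- ★★ **Polynomial form of §6.**  `q ∈ ℂ[X]` monic with all roots in `‖z‖ ≤ R < 1`; if `Σ_{j ≤ deg q} q_j (d_{n+1+j} − d_{n+j}) = 0` for all `n` (the recurrence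
with characteristic polynomial `(X − 1)q`), then `d_n → L` with `‖d_n − L‖ ≤ C'(n+1)^{deg q}Rⁿ`, where `L = (Σ_j q_j d_j)/q(1)`.
[cite: Stanley2012EC1, §4.1 Theorem 4.1.1 (iii); lane statement] -/
theorem exists_norm_sub_le_of_linearRecurrence_one {q : ℂ[X]} (hq : q.Monic) {R : ℝ} (hR : 0 < R) (hR1 : R < 1)
    (hroot : ∀ z : ℂ, q.IsRoot z → ‖z‖ ≤ R) {d : ℕ → ℂ}
    (hd : ∀ n : ℕ, ∑ j ∈ range (q.natDegree + 1), q.coeff j * (d (n + 1 + j) - d (n + j)) = 0) :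
    ∃ L : ℂ, ∃ C' : ℝ, 0 ≤ C' ∧ ∀ n : ℕ, ‖d n - L‖ ≤ C' * ((n : ℝ) + 1) ^ q.natDegree * R ^ n := by
  set rs : List ℂ := q.roots.toList with hrs
  have hcard : Multiset.card q.roots = q.natDegree := IsAlgClosed.card_roots_eq_natDegree
  have hprod : (rs.map fun σ => X - C σ).prod = q := by
    have h := prod_multiset_X_sub_C_of_monic_of_roots_card_eq hq hcard
    rw [hrs, ← Multiset.prod_coe, ← Multiset.map_coe, Multiset.coe_toList]
    exact h
  have hlen : rs.length = q.natDegree := by rw [hrs, Multiset.length_toList, hcard]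
  have hmem : ∀ σ ∈ rs, ‖σ‖ ≤ R := fun σ hσ => by
    rw [hrs, Multiset.mem_toList, mem_roots hq.ne_zero] at hσ
    exact hroot σ hσ
  have hdefl : ∀ n, recDeflate rs d (n + 1) = recDeflate rs d n := fun n => by
    rw [recDeflate_eq_sum_coeff, recDeflate_eq_sum_coeff, hprod, hlen, ← sub_eq_zero, ← Finset.sum_sub_distrib, ← hd n]
    exact Finset.sum_congr rfl fun j _ => by ring
  obtain ⟨C', hC', hb⟩ := exists_norm_sub_le_of_recDeflate_const hR hR1 hmem hdefl
  exact ⟨_, C', hC', fun n => by rw [← hlen]; exact hb n⟩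

end Literature.Analysis
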